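import Summits.Ventures.CertifiedManyBodySolver.Observables.TorusPairLROCeilingTTPrime
import Literature.MathematicalPhysics.QuantumLattice.PairStructureFactorFejerWindow

/-!
# WHERE CAN `[BN7]` FAIL? Window tightness is forced whenever the torus pair LRO attains its Koma–Tasaki value

Cell `hubbard-cq` (venture `CertifiedManyBodySolver`; seat hubbard-cq-p6, row p4–p6 «finite-`h` Koma–Tasaki dictionary»;
sharpening of census (44)/(47)/(10′)(a)). `[BN7] ≡ WINDOW TIGHTNESS` of a sequence of torus vectors `ψ_{L_j}` means: the
small-momentum tail of the pair structure factor, `T_ε(ψ)/L² = windowTail g L ψ ε = L⁻² Σ_{m ≠ 0, |q_m| ≤ ε} S_ψ(m)`,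
becomes uniformly small as `ε ↓ 0`; spelled out (no definition is introduced):
`∀ τ > 0, ∃ ε₀ > 0, ∀ ε ∈ (0, ε₀], ∀ᶠ j, windowTail g (L_j) (ψ_{L_j}) ε ≤ τ`. hubbard-cq-p6's (F4)–(F6) and hubbard-cq-p4's
`tendsto_torusDiagonal_sq_dWaveOrderParameterTT'_of_unique_symmetric_of_tight` use tightness as an INPUT (tightness ∧
`[U]` ⇒ `s_{L_j} → (m⋆)²` at `h = 0`). This file proves the CONVERSE MECHANISM and locates the obstruction:

* §1 `IsTorusLimitOf.exists_forall_eventually_windowTail_le_of_tendsto` — ABSTRACT (any form factor `g`): if along a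
  torus-convergent sequence `ψ_{L_j} → ω` the torus diagonals converge, `s_{L_j} → c`, to a number that the limit state's
  box averages do not exceed asymptotically (`∀ δ > 0, ∀ᶠ n, boxavg_n(ω) ≤ c + δ`), then the sequence is WINDOW TIGHT.
  Mechanism: the reverse Fejér inequality `s_L + T_ε/(4L²)·L² ≤ b_{L,n}` (hubbard-cq-p6
  `torusDiagonal_add_windowTail_div_four_le_boxAvgPairCorr`, Fejér weights `≥ 1/4` on the window `nε ≤ π/6`) and
  `b_{L_j,n} → boxavg_n(ω)` (`IsTorusLimitOf.tendsto_boxAvgPairCorr`).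
* §2 SOURCED TORI, `h > 0`, OFF THE KINKS (`eventually_windowTail_le_of_groundStates_of_hasDerivAt`): every
  torus-convergent sequence of unit ground-state vectors of `A_L(h) = dWaveSourceTorusTT' L t' U μ h` is window tight —
  by hubbard-cq-p4's clustering `s_{L_j} → (E'(h)/2)²` and hubbard-cq-p3's ceiling `tiGroundStatePairLROCeiling_holds`.
  The Kac-window infrared input holds, in `o(1)` form, on every SOURCED torus.
* §3 ZERO FIELD: (a) `eventually_windowTail_le_of_groundStates_zero_of_tendsto_sq` — if `s_{L_j} → (m⋆)²` then the
  sequence is window tight (unconditional: p3's zero-field ceiling on the limit state); (b)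
  `eventually_windowTail_le_of_groundStates_zero_of_not_hasDWaveOrderTT'` — if `m⋆ = 0` EVERY torus-convergent
  ground-state sequence is window tight; (c) the summit's class `eventually_windowTail_le_of_sectorGroundStates` — if
  `m⋆(t',U,μ) = 0` at every `μ` supporting a density-`n` translation-invariant ground state, every torus-convergent
  sequence of sector ground states of `hubbardTorusTT' L 1 t' U` is window tight. **So `[BN7]` can fail ONLY in the
  PRESENT world (`m⋆ > 0` at a supporting `μ`): the window obstruction presupposes the order.**
* §4 THE EQUIVALENCE UNDER `[U]` (`windowTight_iff_tendsto_sq_of_unique_symmetric`): for fixed-`N` torus-convergent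
  ground-state sequences of the grand-canonical tori at `h = 0`, under `[U]`,
  **window tightness ⇔ `s_{L_j} → (m⋆)²`** (`⇒`: the format bridge `exists_tightFunction_of_forall_eventually_windowTail_le`
  + p4's theorem by name; `⇐`: §3 (a)). The census row (44)/(47) «torus converse = `[U] ∧ [BN7]`» is thus an `iff` on the
  `[BN7]` side: given `[U]`, tightness is not merely sufficient but NECESSARY AND SUFFICIENT for the torus pair LRO to reach
  the Koma–Tasaki bound.

HONEST SCOPE / WHAT THIS IS NOT: no claim that `[BN7]` holds at `h = 0` when `m⋆ > 0` (that is the open instrument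
question); statements are along torus-CONVERGENT subsequences (every bounded sequence has one,
`InfVolFermionState.exists_isTorusLimitOf_subseq`), the full-sequence form would need the ceiling uniformly over the limit
states; T5-class dictionary theorems; no number, no instrument, no phase sentence; not a superconductivity verdict.
Everything PROVED; no definition, no named fact; zero compute.

References: T. Kennedy, E. H. Lieb, B. S. Shastry, Phys. Rev. Lett. 61 (1988) 2582 [cite: KLS1988PRL, p. 2583];
T. Koma, H. Tasaki, J. Stat. Phys. 76 (1994) 745, §1 [cite: KomaTasaki1994, §1]; T. Koma, H. Tasaki, Commun. Math. Phys.
158 (1993) 191, Thm 7.3 [cite: KomaTasaki1993, Theorem 7.3]; L. Grafakos, *Classical Fourier Analysis* (2008), Prop.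
3.1.7 [cite: Grafakos2008, Prop. 3.1.7].
-/

noncomputable section

namespace Summit.Ventures.CertifiedManyBodySolver.Observables.TorusWindowTightness

open Matrix Finset Filter Topology Set Literature.MathematicalPhysics.QuantumLattice
open Literature.Probability.LatticeModels HubbardWave0 ThermodynamicLimit
open Summit.Ventures.CertifiedManyBodySolver.Observables.SourcedTorusAHM
open Summit.Ventures.CertifiedManyBodySolver.Observables.TorusPairLROCeiling
open scoped ComplexOrder

variable {ψ : ∀ L, Fock (Orb (FermionTorus 2 L))} {Ls : ℕ → ℕ} [∀ j, NeZero (Ls j)] {ω : InfVolFermionState 2}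

/-! ### §1 The abstract mechanism -/

/-- **CONVERGENCE OF THE TORUS DIAGONAL TO THE LIMIT STATE'S ASYMPTOTIC BOX LRO FORCES WINDOW TIGHTNESS.** Along a
torus-convergent sequence of vectors `ψ_{L_j} → ω` (any form factor `g`): if `s_{L_j}(ψ_{L_j}) → c` and the box averages
of `ω` satisfy `∀ δ > 0, ∀ᶠ n, n⁻⁴ Re Σ_{x,y∈[0,n)²} ω(P_x⋆P_y) ≤ c + δ`, then
`∀ τ > 0, ∃ ε₀ > 0, ∀ ε ∈ (0,ε₀], ∀ᶠ j, T_ε(ψ_{L_j})/L_j² ≤ τ`. (Pick `n` with `boxavg_n(ω) ≤ c + τ/16`, `ε₀ = π/(6n)`; then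
`s + T_ε/4 ≤ b_{L,n} → boxavg_n(ω)` while `s → c`.) [cite: Grafakos2008, Prop. 3.1.7] [cite: KLS1988PRL, p. 2583] -/
theorem _root_.Literature.MathematicalPhysics.QuantumLattice.InfVolFermionState.IsTorusLimitOf.exists_forall_eventually_windowTail_le_of_tendsto
    (g : Site 2 → ℝ) (hω : ω.IsTorusLimitOf ψ Ls) (hLs : Tendsto Ls atTop atTop) {c : ℝ}
    (hs : Tendsto (fun j => torusDiagonal g (Ls j) (ψ (Ls j))) atTop (𝓝 c))
    (hceil : ∀ δ : ℝ, 0 < δ → ∀ᶠ n : ℕ in atTop,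
      (((n : ℂ) ^ 4)⁻¹ * ∑ x ∈ halfOpenBox 2 n, ∑ y ∈ halfOpenBox 2 n,
        ω.pairCorr (insert 0 unitSteps) g x y).re ≤ c + δ)
    {τ : ℝ} (hτ : 0 < τ) :
    ∃ ε₀ : ℝ, 0 < ε₀ ∧ ∀ ε : ℝ, 0 < ε → ε ≤ ε₀ →
      ∀ᶠ j in atTop, windowTail g (Ls j) (ψ (Ls j)) ε ≤ τ := by
  -- a box size `n ≥ 1` with `boxavg_n(ω) ≤ c + τ/16`
  obtain ⟨n, hn, hn1⟩ := ((hceil (τ / 16) (by positivity)).and (eventually_ge_atTop 1)).exists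
  have hn0 : n ≠ 0 := by omega
  have hnpos : (0 : ℝ) < (n : ℝ) := by exact_mod_cast hn1
  refine ⟨Real.pi / 6 / (n : ℝ), by positivity, fun ε hε hεle => ?_⟩
  have hnε : (n : ℝ) * ε ≤ Real.pi / 6 := by
    rw [le_div_iff₀ hnpos] at hεle
    linarith
  -- `b_{L_j,n} → boxavg_n(ω)` and `s_{L_j} → c`
  have hb := hω.tendsto_boxAvgPairCorr g hLs n
  have h1 : ∀ᶠ j in atTop, boxAvgPairCorr g (Ls j) (ψ (Ls j)) n <
      (((n : ℂ) ^ 4)⁻¹ * ∑ x ∈ halfOpenBox 2 n, ∑ y ∈ halfOpenBox 2 n,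
        ω.pairCorr (insert 0 unitSteps) g x y).re + τ / 16 :=
    hb.eventually (Iio_mem_nhds (by linarith))
  have h2 : ∀ᶠ j in atTop, c - τ / 8 < torusDiagonal g (Ls j) (ψ (Ls j)) :=
    hs.eventually (Ioi_mem_nhds (by linarith))
  filter_upwards [h1, h2] with j hj1 hj2
  have hrev := torusDiagonal_add_windowTail_div_four_le_boxAvgPairCorr (Ls j) g (ψ (Ls j)) hn0 hε.le hnε
  linarith

/-- **FORMAT BRIDGE**: the `ε₀`-form of window tightness yields a tail-bound FUNCTION `τ(ε)` with `τ → 0` at `0⁺`, the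
hypothesis shape of `IsTorusLimitOf.le_liminf_torusDiagonal_of_forall_le_re_boxAverage` (p6) and of
`tendsto_torusDiagonal_sq_dWaveOrderParameterTT'_of_unique_symmetric_of_tight` (p4). (`τ(ε) = limsup_j T_ε(ψ_{L_j}) + ε`;
the tails are bounded, `0 ≤ T_ε ≤ Σ_m S/L² ≤ K_g²`.) [cite: KLS1988PRL, p. 2583] -/
theorem exists_tightFunction_of_forall_eventually_windowTail_le (g : Site 2 → ℝ)
    (hunit : ∀ j, star (ψ (Ls j)) ⬝ᵥ ψ (Ls j) = 1)
    (H : ∀ τ : ℝ, 0 < τ → ∃ ε₀ : ℝ, 0 < ε₀ ∧ ∀ ε : ℝ, 0 < ε → ε ≤ ε₀ →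
      ∀ᶠ j in atTop, windowTail g (Ls j) (ψ (Ls j)) ε ≤ τ) :
    ∃ τ : ℝ → ℝ, (∀ ε : ℝ, 0 < ε → ∀ᶠ j in atTop, windowTail g (Ls j) (ψ (Ls j)) ε ≤ τ ε) ∧
      Tendsto τ (𝓝[>] 0) (𝓝 0) := by
  set K : ℝ := (2 * ∑ e ∈ insert (0 : Site 2) unitSteps, |g e / Real.sqrt 2|) ^ 2 with hK
  -- a-priori bounds on the tail
  have hT0 : ∀ (L : ℕ) [NeZero L] (φ : Fock (Orb (FermionTorus 2 L))) (ε : ℝ), 0 ≤ windowTail g L φ ε := by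
    intro L _ φ ε
    unfold windowTail
    exact div_nonneg (sum_nonneg fun m _ => pairStructureFactor_nonneg g L φ m) (sq_nonneg _)
  have hTK : ∀ (L : ℕ) [NeZero L] (φ : Fock (Orb (FermionTorus 2 L))) (ε : ℝ), star φ ⬝ᵥ φ = 1 →
      windowTail g L φ ε ≤ K := by
    intro L _ φ ε hφ
    refine le_trans ?_ (sum_pairStructureFactor_div_sq_le g L hφ)
    unfold windowTail
    refine div_le_div_of_nonneg_right ?_ (sq_nonneg _)
    exact sum_le_sum_of_subset_of_nonneg (filter_subset _ _) fun m _ _ => pairStructureFactor_nonneg g L φ m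
  refine ⟨fun ε => limsup (fun j => windowTail g (Ls j) (ψ (Ls j)) ε) atTop + ε, fun ε hε => ?_, ?_⟩
  · have hbdd : IsBoundedUnder (· ≤ ·) atTop (fun j => windowTail g (Ls j) (ψ (Ls j)) ε) :=
      isBoundedUnder_of ⟨K, fun j => hTK (Ls j) (ψ (Ls j)) ε (hunit j)⟩
    have hev := eventually_lt_of_limsup_lt (lt_add_of_pos_right
      (limsup (fun j => windowTail g (Ls j) (ψ (Ls j)) ε) atTop) hε) hbdd
    filter_upwards [hev] with j hj
    exact hj.le
  · rw [Metric.tendsto_nhdsWithin_nhds]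
    intro δ hδ
    obtain ⟨ε₀, hε₀, hε₀P⟩ := H (δ / 3) (by positivity)
    refine ⟨min ε₀ (δ / 3), lt_min hε₀ (by positivity), fun ε hε hdist => ?_⟩
    have hεpos : 0 < ε := hε
    rw [Real.dist_eq, sub_zero, abs_lt] at hdist
    have hε1 : ε < ε₀ := hdist.2.trans_le (min_le_left _ _)
    have hε2 : ε < δ / 3 := hdist.2.trans_le (min_le_right _ _)
    have hcob : IsCoboundedUnder (· ≤ ·) atTop (fun j => windowTail g (Ls j) (ψ (Ls j)) ε) :=
      (isBoundedUnder_of ⟨0, fun j => hT0 (Ls j) (ψ (Ls j)) ε⟩).isCoboundedUnder_le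
    have hbdd : IsBoundedUnder (· ≤ ·) atTop (fun j => windowTail g (Ls j) (ψ (Ls j)) ε) :=
      isBoundedUnder_of ⟨K, fun j => hTK (Ls j) (ψ (Ls j)) ε (hunit j)⟩
    have hup : limsup (fun j => windowTail g (Ls j) (ψ (Ls j)) ε) atTop ≤ δ / 3 :=
      limsup_le_of_le hcob (hε₀P ε hεpos hε1.le)
    have hlo : 0 ≤ limsup (fun j => windowTail g (Ls j) (ψ (Ls j)) ε) atTop :=
      le_limsup_of_frequently_le (Frequently.of_forall fun j => hT0 (Ls j) (ψ (Ls j)) ε) hbdd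
    rw [Real.dist_eq, sub_zero, abs_lt]
    constructor <;> linarith

/-! ### §2 Sourced tori, `h > 0`, off the kinks -/

section Sourced

variable {t' U μ h : ℝ}

/-- **EVERY TORUS-CONVERGENT SOURCED GROUND-STATE SEQUENCE IS WINDOW TIGHT OFF THE KINKS.** For `h > 0` at which
`E = dWaveSourceEnergyDensityTT' t' U μ` is differentiable, unit ground-state vectors `ψ_{L_j}` of `A_{L_j}(t',U,μ,h)`
along `L_j → ∞` with torus limit `ω`: `∀ τ > 0, ∃ ε₀ > 0, ∀ ε ∈ (0,ε₀], ∀ᶠ j, T_ε(ψ_{L_j})/L_j² ≤ τ` — the Kac-window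
infrared input holds (in `o(1)` form) on the sourced torus. (hubbard-cq-p4's clustering `s_{L_j} → (E'(h)/2)²` +
hubbard-cq-p3's ceiling on the translation-invariant ground state `ω` + §1.) [cite: KomaTasaki1993, Theorem 7.3] -/
theorem eventually_windowTail_le_of_groundStates_of_hasDerivAt (hω : ω.IsTorusLimitOf ψ Ls)
    (hLs : Tendsto Ls atTop atTop) (hh : 0 < h) (hunit : ∀ j, star (ψ (Ls j)) ⬝ᵥ ψ (Ls j) = 1)
    (hgs : ∀ j, dWaveSourceTorusTT' (Ls j) t' U μ h *ᵥ ψ (Ls j) =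
      (((dWaveSourceTorusTT' (Ls j) t' U μ h).groundEnergy : ℝ) : ℂ) • ψ (Ls j))
    {e' : ℝ} (hd : HasDerivAt (dWaveSourceEnergyDensityTT' t' U μ) e' h) {τ : ℝ} (hτ : 0 < τ) :
    ∃ ε₀ : ℝ, 0 < ε₀ ∧ ∀ ε : ℝ, 0 < ε → ε ≤ ε₀ →
      ∀ᶠ j in atTop, windowTail dWaveFormFactor (Ls j) (ψ (Ls j)) ε ≤ τ := by
  have hR : derivWithin (dWaveSourceEnergyDensityTT' t' U μ) (Ioi h) h = e' :=
    hd.hasDerivWithinAt.derivWithin (uniqueDiffWithinAt_Ioi h)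
  have hmin := hω.isMeanEnergyMinimiser_sourced hLs hunit t' U μ h hgs
  refine hω.exists_forall_eventually_windowTail_le_of_tendsto dWaveFormFactor hLs
    (tendsto_torusDiagonal_of_groundStates_of_hasDerivAt hLs hh hunit hgs hd) (fun δ hδ => ?_) hτ
  have hc := tiGroundStatePairLROCeiling_holds t' U μ hh.le hmin δ hδ
  rw [hR] at hc
  exact hc

end Sourced

/-! ### §3 Zero field -/

section ZeroField

variable {t' U μ : ℝ}

/-- **At `h = 0`: `s_{L_j} → (m⋆)²` ⇒ window tight** (unconditional). For unit ground-state vectors of the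
grand-canonical `t–t'` tori `dWaveSourceTorusTT' L t' U μ 0` with torus limit `ω`: if the torus pair LRO converges to
the Koma–Tasaki bound `(dWaveOrderParameterTT' t' U μ)²`, the sequence is window tight (p3's zero-field ceiling on `ω`
+ §1). [cite: KomaTasaki1993, Theorem 7.3] [cite: KomaTasaki1994, §1] -/
theorem eventually_windowTail_le_of_groundStates_zero_of_tendsto_sq (hω : ω.IsTorusLimitOf ψ Ls)
    (hLs : Tendsto Ls atTop atTop) (hunit : ∀ j, star (ψ (Ls j)) ⬝ᵥ ψ (Ls j) = 1)
    (hgs : ∀ j, dWaveSourceTorusTT' (Ls j) t' U μ 0 *ᵥ ψ (Ls j) =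
      (((dWaveSourceTorusTT' (Ls j) t' U μ 0).groundEnergy : ℝ) : ℂ) • ψ (Ls j))
    (hs : Tendsto (fun j => torusDiagonal dWaveFormFactor (Ls j) (ψ (Ls j))) atTop
      (𝓝 (dWaveOrderParameterTT' t' U μ ^ 2)))
    {τ : ℝ} (hτ : 0 < τ) :
    ∃ ε₀ : ℝ, 0 < ε₀ ∧ ∀ ε : ℝ, 0 < ε → ε ≤ ε₀ →
      ∀ᶠ j in atTop, windowTail dWaveFormFactor (Ls j) (ψ (Ls j)) ε ≤ τ := by
  have hmin := hω.isMeanEnergyMinimiser_sourced hLs hunit t' U μ 0 hgs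
  have hsq0 : (derivWithin (dWaveSourceEnergyDensityTT' t' U μ) (Ioi 0) 0 / 2) ^ 2 =
      dWaveOrderParameterTT' t' U μ ^ 2 := by
    rw [dWaveOrderParameterTT'_eq_neg_half_rightDeriv]; ring
  refine hω.exists_forall_eventually_windowTail_le_of_tendsto dWaveFormFactor hLs hs (fun δ hδ => ?_) hτ
  have hc := tiGroundStatePairLROCeiling_holds t' U μ le_rfl hmin δ hδ
  rw [hsq0] at hc
  exact hc

/-- **At `h = 0` with NO quasi-average order (`m⋆ = 0`): EVERY torus-convergent ground-state sequence is window tight.**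
(p4's zero-field ceiling gives `s_{L_j} → 0 = (m⋆)²`.) So `[BN7]` can only fail where `m⋆ > 0`: the window obstruction
PRESUPPOSES the order. [cite: KomaTasaki1993, Theorem 7.3] [cite: KomaTasaki1994, §1] -/
theorem eventually_windowTail_le_of_groundStates_zero_of_not_hasDWaveOrderTT' (hω : ω.IsTorusLimitOf ψ Ls)
    (hLs : Tendsto Ls atTop atTop) (hunit : ∀ j, star (ψ (Ls j)) ⬝ᵥ ψ (Ls j) = 1)
    (hgs : ∀ j, dWaveSourceTorusTT' (Ls j) t' U μ 0 *ᵥ ψ (Ls j) =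
      (((dWaveSourceTorusTT' (Ls j) t' U μ 0).groundEnergy : ℝ) : ℂ) • ψ (Ls j))
    (hno : ¬ HasDWaveOrderTT' t' U μ) {τ : ℝ} (hτ : 0 < τ) :
    ∃ ε₀ : ℝ, 0 < ε₀ ∧ ∀ ε : ℝ, 0 < ε → ε ≤ ε₀ →
      ∀ᶠ j in atTop, windowTail dWaveFormFactor (Ls j) (ψ (Ls j)) ε ≤ τ := by
  have h0 : dWaveOrderParameterTT' t' U μ = 0 :=
    le_antisymm (not_lt.1 hno) (dWaveOrderParameterTT'_nonneg t' U μ)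
  refine eventually_windowTail_le_of_groundStates_zero_of_tendsto_sq hω hLs hunit hgs ?_ hτ
  rw [h0, tendsto_order]
  refine ⟨fun a ha => Eventually.of_forall fun j => ?_, fun b hb => ?_⟩
  · have := torusDiagonal_nonneg dWaveFormFactor (Ls j) (ψ (Ls j))
    have ha' : a < 0 := by simpa using ha
    linarith
  · have hb' : 0 < b := by simpa using hb
    filter_upwards [eventually_torusDiagonal_le_sq_dWaveOrderParameterTT'_add hLs hunit hgs (half_pos hb')] with j hj
    rw [h0] at hj
    linarith

variable {n : ℝ}

/-- **THE SUMMIT'S CLASS: in the ABSENT world `[BN7]` is automatic.** For unit sector ground states `ψ_{L_j}` of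
`hubbardTorusTT' (Ls j) 1 t' U` in the sectors `(rectN n (Ls j), S^z = 0)` (`U ≥ 0`, `0 < n < 2`, `L_j → ∞`) with torus
limit `ω`: if `m⋆(t',U,μ) = 0` at EVERY chemical potential `μ` supporting a density-`n` translation-invariant ground state,
the sequence is window tight (p4's `tendsto_torusDiagonal_zero_of_sectorGroundStates`, `ω` is such a ground state at a
supporting `μ`, p3's zero-field ceiling, §1). [cite: KomaTasaki1993, Theorem 7.3] [cite: KomaTasaki1994, §1] -/
theorem eventually_windowTail_le_of_sectorGroundStates (hU : 0 ≤ U) (hn0 : 0 < n) (hn2 : n < 2)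
    (hω : ω.IsTorusLimitOf ψ Ls) (hLs : Tendsto Ls atTop atTop)
    (hψ : ∀ j, IsGroundStateInSector (hubbardTorusTT' (Ls j) 1 t' U) (rectN n (Ls j)) 0 (ψ (Ls j)))
    (hunit : ∀ j, star (ψ (Ls j)) ⬝ᵥ ψ (Ls j) = 1)
    (hno : ∀ (μ : ℝ) (ω' : InfVolFermionState 2), ω'.IsMeanEnergyMinimiser (hubbardTTPrimeMuInteraction 1 t' U μ) 1 →
      ω'.density = n → ¬ HasDWaveOrderTT' t' U μ)
    {τ : ℝ} (hτ : 0 < τ) :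
    ∃ ε₀ : ℝ, 0 < ε₀ ∧ ∀ ε : ℝ, 0 < ε → ε ≤ ε₀ →
      ∀ᶠ j in atTop, windowTail dWaveFormFactor (Ls j) (ψ (Ls j)) ε ≤ τ := by
  obtain ⟨-, -, hρ, -, μ, hμ⟩ := hω.symmetric_groundState_of_sectorGroundStates t' hU hn0 hn2 hLs hψ hunit
  have h0 : dWaveOrderParameterTT' t' U μ = 0 :=
    le_antisymm (not_lt.1 (hno μ ω hμ hρ)) (dWaveOrderParameterTT'_nonneg t' U μ)
  refine hω.exists_forall_eventually_windowTail_le_of_tendsto dWaveFormFactor hLs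
    (tendsto_torusDiagonal_zero_of_sectorGroundStates hU hn0 hn2 hLs hψ hunit hno) (fun δ hδ => ?_) hτ
  have hc := zeroFieldPairLROCeiling_holds t' U μ hμ δ hδ
  rw [h0, show ((0 : ℝ) ^ 2 + δ) = 0 + δ by ring] at hc
  exact hc

end ZeroField

/-! ### §4 The equivalence under `[U]` -/

section Iff

variable {t' U μ : ℝ}

/-- **UNDER `[U]`, WINDOW TIGHTNESS ⇔ THE TORUS PAIR LRO REACHES THE KOMA–TASAKI BOUND.** For a fixed-`N` sequence of unit
ground-state vectors `ψ_{L_j}` of the grand-canonical `t–t'` tori `dWaveSourceTorusTT' L t' U μ 0` with torus limit `ω`, and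
the uniqueness hypothesis `[U]` on the gauge-invariant translation-invariant ground state at `(t',U,μ)`:
`(∀ τ > 0, ∃ ε₀ > 0, ∀ ε ∈ (0,ε₀], ∀ᶠ j, T_ε(ψ_{L_j})/L_j² ≤ τ) ↔ s_{L_j} → (dWaveOrderParameterTT' t' U μ)²`
(`→`: the format bridge + hubbard-cq-p4's `tendsto_torusDiagonal_sq_dWaveOrderParameterTT'_of_unique_symmetric_of_tight`
(p6's (F5) floor + p4's ceiling); `←`: §3, no `[U]` needed). The census row «torus converse = `[U] ∧ [BN7]`» is an `iff` on
the `[BN7]` side. [cite: KomaTasaki1994, §1] [cite: KomaTasaki1993, Theorem 7.3] -/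
theorem windowTight_iff_tendsto_sq_of_unique_symmetric
    (hU : ∀ ω₁ ω₂ : InfVolFermionState 2,
      ω₁.IsMeanEnergyMinimiser (hubbardTTPrimeMuInteraction 1 t' U μ) 1 → ω₁.IsGaugeInvariant →
      ω₂.IsMeanEnergyMinimiser (hubbardTTPrimeMuInteraction 1 t' U μ) 1 → ω₂.IsGaugeInvariant → ω₁ = ω₂)
    (hω : ω.IsTorusLimitOf ψ Ls) (hLs : Tendsto Ls atTop atTop)
    (hunit : ∀ j, star (ψ (Ls j)) ⬝ᵥ ψ (Ls j) = 1) {N : ℕ → ℕ} (hN : ∀ j, IsNParticle (N j) (ψ (Ls j)))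
    (hgs : ∀ j, dWaveSourceTorusTT' (Ls j) t' U μ 0 *ᵥ ψ (Ls j) =
      (((dWaveSourceTorusTT' (Ls j) t' U μ 0).groundEnergy : ℝ) : ℂ) • ψ (Ls j)) :
    (∀ τ : ℝ, 0 < τ → ∃ ε₀ : ℝ, 0 < ε₀ ∧ ∀ ε : ℝ, 0 < ε → ε ≤ ε₀ →
        ∀ᶠ j in atTop, windowTail dWaveFormFactor (Ls j) (ψ (Ls j)) ε ≤ τ) ↔
      Tendsto (fun j => torusDiagonal dWaveFormFactor (Ls j) (ψ (Ls j))) atTop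
        (𝓝 (dWaveOrderParameterTT' t' U μ ^ 2)) := by
  constructor
  · intro H
    obtain ⟨τ, hτ, hτ0⟩ := exists_tightFunction_of_forall_eventually_windowTail_le dWaveFormFactor hunit H
    exact tendsto_torusDiagonal_sq_dWaveOrderParameterTT'_of_unique_symmetric_of_tight hU hω hLs hunit hN hgs hτ hτ0
  · intro hs τ hτ
    exact eventually_windowTail_le_of_groundStates_zero_of_tendsto_sq hω hLs hunit hgs hs hτ

end Iff

end Summit.Ventures.CertifiedManyBodySolver.Observables.TorusWindowTightness

end
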